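import Mathlib
import Summits.Ventures.DiscreteObjects.Mahler.SubLehmerDegreeFourteen
import Summits.Ventures.DiscreteObjects.Mahler.HeightCells
import Summits.Ventures.DiscreteObjects.Mahler.Height1Ladder

/-!
# The first rungs of the sub-Lehmer ladder, unconditionally (venture `DiscreteObjects`, target L)

Cell `pub-namedobj`, seat `pub-namedobj-mahler-g12`. Framing: lottery ticket; floor = certified bounds/negative
ranges.

The cell's typed ladder `HeightSubLehmerEmptyUpTo h N` / `Height1SubLehmerEmptyUpTo N` ("no integer polynomial of degree
`≤ N` and height `≤ h` is sub-Lehmer") was so far available below degree 56 only CONDITIONALLY on the named fact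
`SubLehmerDegreeBound` (MRW08 Thm 1.1). From the kernel census (`fourteen_le_natDegree_of_subLehmer`) the rungs `N ≤ 13`
now hold with NO hypothesis, at every height, and so does every cell `HeightCell h s d` with `d ≤ 13`.
-/

namespace Summit.Ventures.DiscreteObjects.Mahler

open Polynomial

/-- **Rungs `N ≤ 13` of the sub-Lehmer ladder, unconditionally, at every height bound `h`.** -/
theorem heightSubLehmerEmptyUpTo_of_le_thirteen (h : ℕ) {N : ℕ} (hN : N ≤ 13) : HeightSubLehmerEmptyUpTo h N := by
  intro P hdeg _ hP
  have := fourteen_le_natDegree_of_subLehmer hP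
  omega

/-- Height-1 rungs `N ≤ 13`, unconditionally. -/
theorem height1SubLehmerEmptyUpTo_of_le_thirteen {N : ℕ} (hN : N ≤ 13) : Height1SubLehmerEmptyUpTo N :=
  (heightSubLehmerEmptyUpTo_one_iff N).mp (heightSubLehmerEmptyUpTo_of_le_thirteen 1 hN)

/-- Every cell `HeightCell h s d` with core degree `d ≤ 13` holds unconditionally. -/
theorem heightCell_of_le_thirteen (h : ℕ) (s : Multiset ℕ) {d : ℕ} (hd : d ≤ 13) : HeightCell h s d := by
  intro Q hdeg _ _ _ _ _ hQ
  have := fourteen_le_natDegree_of_subLehmer hQ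
  omega

end Summit.Ventures.DiscreteObjects.Mahler
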